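import Summits.KontsevichZagierPeriods.KontsevichZagierPeriods.Theses.RootDecompQuadraticDescent
import Literature.NumberTheory.Transcendental.KZCubeRationalMoves
import HarnessLib

/-!
# Route RootDecompQuadraticDescent (node F′) — census dark pairs of weight two DECIDED by moves — part 1/2 (`…DarkPairsEleven`): the reflection move, small tools, census pairs #11 and #13

Theorems-split (2 files ≤ 400 lines) of the decomp-kz lens-6 gen-6 file `run/shared/lean/pub/decomp-kz/decomp-kz-lens-6/g6/RootDecompQuadraticDescentDarkPairs.lean`
(@95ee4a45, 650 lines; lens farm rc 0 / 0 sorry / standard axioms; critic decomp-kz-crit-1 g2 CLEARED 2026-08-30T06:42:55Z; landing ask L12 of the writer),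
landed by the census seat decomp-kz-census-1 g6 (--supports stmt-KontsevichZagierPeriods-28994). FOUR census-dark weight-2 pairs of the HQ = 2 box
(census decomp-kz K-M2-DARK #9, #11, #13, #14, all of ratio 1 : 2) are proved CONGRUENT in `KZ.relations` by explicit 3–4-move chains using rules (1) and (2)
only (fold + central symmetry `Q(1−x,1−y)` + subdivision), hence are DECIDED instances of `DescentTwoQ` (item 28994) and of `KZDimTwo` (item 4280) with no
use of the oracle hypotheses. The reflection move `xᵢ ↦ 1 − xᵢ` of `Theorems/HermiteRigidityIslandComplementCubeReflection.lean` (module unbuilt on the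
farm today) is carried as file-local copies. [Kontsevich–Zagier 2001 §1.2] Standard axioms, 0 sorry, no new instances, no notation.
-/

noncomputable section

set_option linter.dupNamespace false

open MeasureTheory Set MvPolynomial

namespace Summit.KontsevichZagierPeriods.RootDecompQuadraticDescent.DarkPairs

open Literature.NumberTheory.Transcendental
open Literature.NumberTheory.Transcendental.KZ
open Literature.ModelTheory.ExponentialFields (IsSemialgebraic)

/-- Helper (theorem) `reflect_reflect` of the dark-pairs chains (census pairs #9/#11/#13/#14 decided by KZ rules 1+2; lens-6 g6). -/
private theorem reflect_reflect {M : ℕ} (i : Fin M) (x : Fin M → ℝ) :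
    Function.update (Function.update x i (1 - x i)) i
        (1 - Function.update x i (1 - x i) i) = x := by
  funext j
  rcases eq_or_ne j i with rfl | hj
  · simp
  · simp [Function.update_of_ne hj]

/-- Helper (theorem) `image_reflect_cube` of the dark-pairs chains (census pairs #9/#11/#13/#14 decided by KZ rules 1+2; lens-6 g6). -/
private theorem image_reflect_cube {M : ℕ} (i : Fin M) :
    (fun x : Fin M → ℝ => Function.update x i (1 - x i)) '' cube M = cube M := by
  refine Subset.antisymm ?_ fun y hy => ?_
  · rintro _ ⟨x, hx, rfl⟩
    exact KZ.update_mem_cube hx i (by linarith [(hx i).2]) (by linarith [(hx i).1])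
  · refine ⟨Function.update y i (1 - y i),
      KZ.update_mem_cube hy i (by linarith [(hy i).2]) (by linarith [(hy i).1]), ?_⟩
    exact reflect_reflect i y

/-- Helper (theorem) `reflectDeriv_apply` of the dark-pairs chains (census pairs #9/#11/#13/#14 decided by KZ rules 1+2; lens-6 g6). -/
private theorem reflectDeriv_apply {M : ℕ} (i : Fin M) (v : Fin M → ℝ) (j : Fin M) :
    ((ContinuousLinearMap.id ℝ (Fin M → ℝ) -
        ((2:ℝ) • ContinuousLinearMap.proj (R := ℝ) (φ := fun _ : Fin M => ℝ) i).smulRight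
          (Pi.single i (1:ℝ) : Fin M → ℝ) : (Fin M → ℝ) →L[ℝ] (Fin M → ℝ))) v j = if j = i then -v i else v j := by
  simp only [sub_apply, ContinuousLinearMap.id_apply, ContinuousLinearMap.smulRight_apply,
    smul_apply, ContinuousLinearMap.proj_apply, Pi.sub_apply, Pi.smul_apply, smul_eq_mul,
    Pi.single_apply, mul_ite, mul_one, mul_zero]
  split_ifs with hj
  · subst hj; ring
  · ring

/-- Helper (theorem) `abs_det_reflectDeriv` of the dark-pairs chains (census pairs #9/#11/#13/#14 decided by KZ rules 1+2; lens-6 g6). -/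
private theorem abs_det_reflectDeriv {M : ℕ} (i : Fin M) :
    |((ContinuousLinearMap.id ℝ (Fin M → ℝ) -
        ((2:ℝ) • ContinuousLinearMap.proj (R := ℝ) (φ := fun _ : Fin M => ℝ) i).smulRight
          (Pi.single i (1:ℝ) : Fin M → ℝ) : (Fin M → ℝ) →L[ℝ] (Fin M → ℝ))).det| = 1 := by
  set L := (ContinuousLinearMap.id ℝ (Fin M → ℝ) -
    ((2:ℝ) • ContinuousLinearMap.proj (R := ℝ) (φ := fun _ : Fin M => ℝ) i).smulRight
      (Pi.single i (1:ℝ) : Fin M → ℝ) : (Fin M → ℝ) →L[ℝ] (Fin M → ℝ)) with hL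
  have hinv : (L : (Fin M → ℝ) →ₗ[ℝ] (Fin M → ℝ)).comp (L : (Fin M → ℝ) →ₗ[ℝ] (Fin M → ℝ)) =
      LinearMap.id := by
    refine LinearMap.ext fun v => funext fun j => ?_
    rw [LinearMap.comp_apply, ContinuousLinearMap.coe_coe, LinearMap.id_apply, hL,
      reflectDeriv_apply, reflectDeriv_apply]
    rcases eq_or_ne j i with rfl | hj
    · simp
    · simp [hj]
  have h := congrArg LinearMap.det hinv
  rw [LinearMap.det_comp, LinearMap.det_id] at h
  rw [ContinuousLinearMap.det]
  rcases mul_self_eq_one_iff.mp h with h1 | h1 <;> simp [h1]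

/-- Helper (theorem) `hasFDerivAt_reflect` of the dark-pairs chains (census pairs #9/#11/#13/#14 decided by KZ rules 1+2; lens-6 g6). -/
private theorem hasFDerivAt_reflect {M : ℕ} (i : Fin M) (x : Fin M → ℝ) :
    HasFDerivAt (fun y : Fin M → ℝ => Function.update y i (1 - y i))
      ((ContinuousLinearMap.id ℝ (Fin M → ℝ) -
        ((2:ℝ) • ContinuousLinearMap.proj (R := ℝ) (φ := fun _ : Fin M => ℝ) i).smulRight
          (Pi.single i (1:ℝ) : Fin M → ℝ) : (Fin M → ℝ) →L[ℝ] (Fin M → ℝ))) x := by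
  have h0 : HasFDerivAt (fun y : Fin M → ℝ => 2 * y i - 1)
      ((2:ℝ) • ContinuousLinearMap.proj (R := ℝ) (φ := fun _ : Fin M => ℝ) i) x :=
    ((hasFDerivAt_apply i x).const_mul (2:ℝ)).sub_const 1
  have h1 := (hasFDerivAt_id x).sub (h0.smul_const (Pi.single i (1:ℝ)))
  refine h1.congr_of_eventuallyEq (Filter.Eventually.of_forall fun y => ?_)
  funext j
  simp only [Pi.sub_apply, id_eq, Pi.smul_apply, Pi.single_apply, smul_eq_mul, mul_ite, mul_one,
    mul_zero, Function.update_apply]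
  split_ifs with hj
  · subst hj; ring
  · ring

/-- Helper (theorem) `isSemialgebraicMapOn_reflect` of the dark-pairs chains (census pairs #9/#11/#13/#14 decided by KZ rules 1+2; lens-6 g6). -/
private theorem isSemialgebraicMapOn_reflect {M : ℕ} (i : Fin M) :
    IsSemialgebraicMapOn ℚ (cube M) (fun y : Fin M → ℝ => Function.update y i (1 - y i)) := by
  refine (isSemialgebraicMapOn_aeval isSemialgebraic_cube
    (Function.update (fun j => (X j : MvPolynomial (Fin M) ℚ)) i (1 - X i))).congr fun x _ => ?_
  funext j
  rcases eq_or_ne j i with rfl | hj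
  · simp
  · simp [Function.update_of_ne hj]

/-- The reflection move for tame cube representations. [cite: KontsevichZagier2001, §1.2 rule (2)] -/
theorem rel_reflect_rep (M : ℕ) (i : Fin M) (r r' : IntegralRep M) (hr : r.IsTameCube)
    (hr' : r'.IsTameCube)
    (h : ∀ x ∈ cube M, r.integrand x = r'.integrand (Function.update x i (1 - x i))) :
    KZ.of r - KZ.of r' ∈ KZ.relations := by
  refine cubicalCovGens_subset_relations (mem_cubicalCovGens hr hr'
    (Φ := fun y : Fin M → ℝ => Function.update y i (1 - y i))
    (Φ' := fun _ => (ContinuousLinearMap.id ℝ (Fin M → ℝ) -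
        ((2:ℝ) • ContinuousLinearMap.proj (R := ℝ) (φ := fun _ : Fin M => ℝ) i).smulRight
          (Pi.single i (1:ℝ) : Fin M → ℝ) : (Fin M → ℝ) →L[ℝ] (Fin M → ℝ)))
    (isSemialgebraicMapOn_reflect i) (fun x _ => (hasFDerivAt_reflect i x).hasFDerivWithinAt)
    (fun x _ y _ hxy => ?_) (image_reflect_cube i) (fun j => ?_) fun x hx => ?_)
  · have hx := reflect_reflect i x
    have hy := reflect_reflect i y
    simp only at hxy
    rw [← hx, ← hy, hxy]
  · rcases eq_or_ne j i with rfl | hj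
    · simp only [Function.update_self]
      exact fun x _ => analyticAt_const.sub
        ((ContinuousLinearMap.proj (R := ℝ) (φ := fun _ : Fin M => ℝ) j).analyticAt x)
    · simp only [Function.update_of_ne hj]
      exact fun x _ => (ContinuousLinearMap.proj (R := ℝ) (φ := fun _ : Fin M => ℝ) j).analyticAt x
  · rw [abs_det_reflectDeriv, mul_one]
    exact h x hx

/-- **The reflection move for regular rational functions**: `S(x) = T(x with xᵢ := 1 − xᵢ)` on the
cube gives `[□ᴹ, S] − [□ᴹ, T] ∈ KZ.relations`. [cite: KontsevichZagier2001, §1.2 rule (2)] -/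
private theorem rel_reflect {M : ℕ} (i : Fin M) (T S : RFun M)
    (h : ∀ x ∈ cube M, S.fn x = T.fn (Function.update x i (1 - x i))) :
    KZ.of S.rep - KZ.of T.rep ∈ KZ.relations :=
  rel_reflect_rep M i S.rep T.rep S.isTameCube_rep T.isTameCube_rep h

/-- Helper (theorem) `update_zero_apply_one` of the dark-pairs chains (census pairs #9/#11/#13/#14 decided by KZ rules 1+2; lens-6 g6). -/
@[simp] private theorem update_zero_apply_one (x : Fin 2 → ℝ) (a : ℝ) : Function.update x 0 a 1 = x 1 :=
  Function.update_of_ne (by decide) a x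

/-- Helper (theorem) `update_one_apply_zero` of the dark-pairs chains (census pairs #9/#11/#13/#14 decided by KZ rules 1+2; lens-6 g6). -/
@[simp] theorem update_one_apply_zero (x : Fin 2 → ℝ) (a : ℝ) : Function.update x 1 a 0 = x 0 :=
  Function.update_of_ne (by decide) a x

/-- `1/P = c · 1/D` as soon as `c · P = D` (`c ≠ 0`). [folklore] -/
theorem one_div_eq_mul_one_div {P D c : ℝ} (hc : c ≠ 0) (h : c * P = D) : 1 / P = c * (1 / D) := by
  rw [← h, one_div, one_div, mul_inv, ← mul_assoc, mul_inv_cancel₀ hc, one_mul]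

/-- The dyadic subdivision move along `xᵢ` for regular rational functions (rules 1a + 2).
[cite: KontsevichZagier2001, §1.2 rules (1), (2)] -/
theorem rel_subdiv (i : Fin 2) (A L U : RFun 2)
    (hL : ∀ x ∈ cube 2, L.fn x = (1 / 2 : ℝ) * A.fn (Function.update x i (x i / 2)))
    (hU : ∀ x ∈ cube 2, U.fn x = (1 / 2 : ℝ) * A.fn (Function.update x i ((1 + x i) / 2))) :
    KZ.of A.rep - KZ.of L.rep - KZ.of U.rep ∈ KZ.relations :=
  KZ.cubicalSubdivGens_subset_relations (KZ.mem_cubicalSubdivGens A.isTameCube_rep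
    L.isTameCube_rep U.isTameCube_rep i hL hU)

/-- The fold: subdivision `[A] ≡ [L] + [U]` and two symmetries `[B] ≡ [L]`, `[B] ≡ [U]` give
`[A] − 2·[B] ∈ KZ.relations`. [folklore] -/
theorem rel_fold (A B L U : RFun 2)
    (hA : KZ.of A.rep - KZ.of L.rep - KZ.of U.rep ∈ KZ.relations)
    (hL : KZ.of B.rep - KZ.of L.rep ∈ KZ.relations) (hU : KZ.of B.rep - KZ.of U.rep ∈ KZ.relations) :
    KZ.of A.rep - 2 • KZ.of B.rep ∈ KZ.relations := by
  have : KZ.of A.rep - 2 • KZ.of B.rep = (KZ.of A.rep - KZ.of L.rep - KZ.of U.rep)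
      - (KZ.of B.rep - KZ.of L.rep) - (KZ.of B.rep - KZ.of U.rep) := by abel
  rw [this]
  exact KZ.relations.sub_mem (KZ.relations.sub_mem hA hL) hU

/-- Doubling the integrand: `[□, 2T] − 2·[□, T] ∈ KZ.relations` (rule 1b).
[cite: KontsevichZagier2001, §1.2 rule (1)] -/
theorem rel_double (T T2 : RFun 2) (h : ∀ x ∈ cube 2, T2.fn x = T.fn x + T.fn x) :
    KZ.of T2.rep - 2 • KZ.of T.rep ∈ KZ.relations := by
  have h1 : KZ.of T2.rep - KZ.of T.rep - KZ.of T.rep ∈ KZ.relations :=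
    KZ.cubicalLinGens_subset_relations (KZ.mem_cubicalLinGens T2.isTameCube_rep T.isTameCube_rep
      T.isTameCube_rep fun x hx => by simpa using h x hx)
  have : KZ.of T2.rep - 2 • KZ.of T.rep = KZ.of T2.rep - KZ.of T.rep - KZ.of T.rep := by abel
  rwa [this]

/-- A regular rational function gives a KZ-rational representation. [folklore] -/
private theorem isRational_rep {M : ℕ} (T : RFun M) : T.rep.IsRational :=
  ⟨T.num, T.den, T.den_ne, fun _ _ => rfl⟩

/-- `Q_A = 1 − x + y + 2x² − 2xy`. -/
def QA11 : MvPolynomial (Fin 2) ℚ := 1 - X 0 + X 1 + 2 * X 0 ^ 2 - 2 * X 0 * X 1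

/-- `Q_B = 2 − x + x² + 2xy = 2·Q_A((1−x)/2, y)`. -/
def QB11 : MvPolynomial (Fin 2) ℚ := 2 - X 0 + X 0 ^ 2 + 2 * X 0 * X 1

/-- `2·Q_A(x/2, y)`. -/
def QL11 : MvPolynomial (Fin 2) ℚ := 2 - X 0 + 2 * X 1 + X 0 ^ 2 - 2 * X 0 * X 1

/-- `2·Q_A((1+x)/2, y)`. -/
def QU11 : MvPolynomial (Fin 2) ℚ := 2 + X 0 + X 0 ^ 2 - 2 * X 0 * X 1

/-- Helper (theorem) `QA11_pos` of the dark-pairs chains (census pairs #9/#11/#13/#14 decided by KZ rules 1+2; lens-6 g6). -/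
theorem QA11_pos {x : Fin 2 → ℝ} (hx : x ∈ cube 2) : 0 < aeval x QA11 := by
  obtain ⟨h0l, h0u⟩ := hx 0; obtain ⟨h1l, h1u⟩ := hx 1
  simp only [QA11, map_add, map_sub, map_mul, map_pow, map_one, map_ofNat, aeval_X]
  nlinarith [sq_nonneg (x 0 - (2 * x 1 + 1) / 4), mul_nonneg h1l (sub_nonneg.2 h1u)]

/-- Helper (theorem) `QB11_pos` of the dark-pairs chains (census pairs #9/#11/#13/#14 decided by KZ rules 1+2; lens-6 g6). -/
theorem QB11_pos {x : Fin 2 → ℝ} (hx : x ∈ cube 2) : 0 < aeval x QB11 := by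
  obtain ⟨h0l, h0u⟩ := hx 0; obtain ⟨h1l, h1u⟩ := hx 1
  simp only [QB11, map_add, map_sub, map_mul, map_pow, map_ofNat, aeval_X]
  nlinarith [sq_nonneg (x 0), mul_nonneg h0l h1l]

/-- Helper (theorem) `QL11_pos` of the dark-pairs chains (census pairs #9/#11/#13/#14 decided by KZ rules 1+2; lens-6 g6). -/
theorem QL11_pos {x : Fin 2 → ℝ} (hx : x ∈ cube 2) : 0 < aeval x QL11 := by
  obtain ⟨h0l, h0u⟩ := hx 0; obtain ⟨h1l, h1u⟩ := hx 1
  simp only [QL11, map_add, map_sub, map_mul, map_pow, map_ofNat, aeval_X]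
  nlinarith [sq_nonneg (x 0 - (2 * x 1 + 1) / 2), mul_nonneg h1l (sub_nonneg.2 h1u)]

/-- Helper (theorem) `QU11_pos` of the dark-pairs chains (census pairs #9/#11/#13/#14 decided by KZ rules 1+2; lens-6 g6). -/
theorem QU11_pos {x : Fin 2 → ℝ} (hx : x ∈ cube 2) : 0 < aeval x QU11 := by
  obtain ⟨h0l, h0u⟩ := hx 0; obtain ⟨h1l, h1u⟩ := hx 1
  simp only [QU11, map_add, map_sub, map_mul, map_pow, map_ofNat, aeval_X]
  nlinarith [sq_nonneg (x 0 + (1 - 2 * x 1) / 2), mul_nonneg h1l (sub_nonneg.2 h1u)]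

/-- `A = [□², 1/Q_A]`. -/
def A11 : RFun 2 := ⟨1, QA11, fun _ hx => (QA11_pos hx).ne'⟩

/-- `B = [□², 1/Q_B]`. -/
def B11 : RFun 2 := ⟨1, QB11, fun _ hx => (QB11_pos hx).ne'⟩

/-- `[□², 2/Q_B]`. -/
def B11two : RFun 2 := ⟨2, QB11, fun _ hx => (QB11_pos hx).ne'⟩

/-- lower half-piece `[□², 1/(2 Q_A(x/2,y))]`. -/
def L11 : RFun 2 := ⟨1, QL11, fun _ hx => (QL11_pos hx).ne'⟩

/-- upper half-piece `[□², 1/(2 Q_A((1+x)/2,y))]`. -/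
def U11 : RFun 2 := ⟨1, QU11, fun _ hx => (QU11_pos hx).ne'⟩

/-- Helper (theorem) `A11_subdiv` of the dark-pairs chains (census pairs #9/#11/#13/#14 decided by KZ rules 1+2; lens-6 g6). -/
theorem A11_subdiv : KZ.of A11.rep - KZ.of L11.rep - KZ.of U11.rep ∈ KZ.relations := by
  refine rel_subdiv 0 A11 L11 U11 (fun x _ => ?_) (fun x _ => ?_)
  · simp only [A11, L11, RFun.fn, QA11, QL11, map_add, map_sub, map_mul, map_pow, map_one, map_ofNat,
      aeval_X, Function.update_self, update_zero_apply_one]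
    exact one_div_eq_mul_one_div (by norm_num) (by ring)
  · simp only [A11, U11, RFun.fn, QA11, QU11, map_add, map_sub, map_mul, map_pow, map_one, map_ofNat,
      aeval_X, Function.update_self, update_zero_apply_one]
    exact one_div_eq_mul_one_div (by norm_num) (by ring)

/-- Helper (theorem) `B11_L11` of the dark-pairs chains (census pairs #9/#11/#13/#14 decided by KZ rules 1+2; lens-6 g6). -/
theorem B11_L11 : KZ.of B11.rep - KZ.of L11.rep ∈ KZ.relations := by
  refine rel_reflect 0 L11 B11 fun x _ => ?_
  simp only [B11, L11, RFun.fn, QB11, QL11, map_add, map_sub, map_mul, map_pow, map_one, map_ofNat,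
    aeval_X, Function.update_self, update_zero_apply_one]
  congr 1; ring

/-- Helper (theorem) `B11_U11` of the dark-pairs chains (census pairs #9/#11/#13/#14 decided by KZ rules 1+2; lens-6 g6). -/
theorem B11_U11 : KZ.of B11.rep - KZ.of U11.rep ∈ KZ.relations := by
  refine rel_reflect 1 U11 B11 fun x _ => ?_
  simp only [B11, U11, RFun.fn, QB11, QU11, map_add, map_sub, map_mul, map_pow, map_one, map_ofNat,
    aeval_X, Function.update_self, update_one_apply_zero]
  congr 1; ring

/-- **Census pair #11 decided**: `[□², 1/(1−x+y+2x²−2xy)] − 2·[□², 1/(2−x+x²+2xy)] ∈ KZ.relations`. -/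
theorem pair11 : KZ.of A11.rep - 2 • KZ.of B11.rep ∈ KZ.relations :=
  rel_fold A11 B11 L11 U11 A11_subdiv B11_L11 B11_U11

/-- Helper (theorem) `pair11_equivalent` of the dark-pairs chains (census pairs #9/#11/#13/#14 decided by KZ rules 1+2; lens-6 g6). -/
theorem pair11_equivalent : KZ.Equivalent A11.rep B11two.rep := by
  have h2 := rel_double B11 B11two fun x _ => by
    simp only [B11, B11two, RFun.fn, map_one, map_ofNat]; ring
  have : KZ.of A11.rep - KZ.of B11two.rep =
      (KZ.of A11.rep - 2 • KZ.of B11.rep) - (KZ.of B11two.rep - 2 • KZ.of B11.rep) := by abel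
  show KZ.of A11.rep - KZ.of B11two.rep ∈ KZ.relations
  rw [this]
  exact KZ.relations.sub_mem pair11 h2

/-- Helper (theorem) `pair11_value` of the dark-pairs chains (census pairs #9/#11/#13/#14 decided by KZ rules 1+2; lens-6 g6). -/
theorem pair11_value : A11.rep.value = B11two.rep.value :=
  KZ.Equivalent.value_eq_holds pair11_equivalent

/-- `Q_A = 1 − x + 2y + 2x² − 2xy − y²`. -/
def QA13 : MvPolynomial (Fin 2) ℚ := 1 - X 0 + 2 * X 1 + 2 * X 0 ^ 2 - 2 * X 0 * X 1 - X 1 ^ 2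

/-- `Q_B = 2 − x + 2y + x² + 2xy − 2y² = 2·Q_A((1−x)/2, y)`. -/
def QB13 : MvPolynomial (Fin 2) ℚ := 2 - X 0 + 2 * X 1 + X 0 ^ 2 + 2 * X 0 * X 1 - 2 * X 1 ^ 2

/-- `2·Q_A(x/2, y)`. -/
def QL13 : MvPolynomial (Fin 2) ℚ := 2 - X 0 + 4 * X 1 + X 0 ^ 2 - 2 * X 0 * X 1 - 2 * X 1 ^ 2

/-- `2·Q_A((1+x)/2, y)`. -/
def QU13 : MvPolynomial (Fin 2) ℚ := 2 + X 0 + 2 * X 1 + X 0 ^ 2 - 2 * X 0 * X 1 - 2 * X 1 ^ 2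

/-- Helper (theorem) `QA13_pos` of the dark-pairs chains (census pairs #9/#11/#13/#14 decided by KZ rules 1+2; lens-6 g6). -/
theorem QA13_pos {x : Fin 2 → ℝ} (hx : x ∈ cube 2) : 0 < aeval x QA13 := by
  obtain ⟨h0l, h0u⟩ := hx 0; obtain ⟨h1l, h1u⟩ := hx 1
  simp only [QA13, map_add, map_sub, map_mul, map_pow, map_one, map_ofNat, aeval_X]
  nlinarith [sq_nonneg (x 0 - (1 + 2 * x 1) / 4), mul_nonneg h1l (sub_nonneg.2 h1u)]

/-- Helper (theorem) `QB13_pos` of the dark-pairs chains (census pairs #9/#11/#13/#14 decided by KZ rules 1+2; lens-6 g6). -/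
theorem QB13_pos {x : Fin 2 → ℝ} (hx : x ∈ cube 2) : 0 < aeval x QB13 := by
  obtain ⟨h0l, h0u⟩ := hx 0; obtain ⟨h1l, h1u⟩ := hx 1
  simp only [QB13, map_add, map_sub, map_mul, map_pow, map_ofNat, aeval_X]
  nlinarith [sq_nonneg (x 0 - (1 - 2 * x 1) / 2), mul_nonneg h1l (sub_nonneg.2 h1u)]

/-- Helper (theorem) `QL13_pos` of the dark-pairs chains (census pairs #9/#11/#13/#14 decided by KZ rules 1+2; lens-6 g6). -/
theorem QL13_pos {x : Fin 2 → ℝ} (hx : x ∈ cube 2) : 0 < aeval x QL13 := by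
  obtain ⟨h0l, h0u⟩ := hx 0; obtain ⟨h1l, h1u⟩ := hx 1
  simp only [QL13, map_add, map_sub, map_mul, map_pow, map_ofNat, aeval_X]
  nlinarith [sq_nonneg (x 0 - (1 + 2 * x 1) / 2), mul_nonneg h1l (sub_nonneg.2 h1u)]

/-- Helper (theorem) `QU13_pos` of the dark-pairs chains (census pairs #9/#11/#13/#14 decided by KZ rules 1+2; lens-6 g6). -/
theorem QU13_pos {x : Fin 2 → ℝ} (hx : x ∈ cube 2) : 0 < aeval x QU13 := by
  obtain ⟨h0l, h0u⟩ := hx 0; obtain ⟨h1l, h1u⟩ := hx 1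
  simp only [QU13, map_add, map_sub, map_mul, map_pow, map_ofNat, aeval_X]
  nlinarith [sq_nonneg (x 0 + (1 - 2 * x 1) / 2), mul_nonneg h1l (sub_nonneg.2 h1u)]

/-- `A = [□², 1/Q_A]`. -/
def A13 : RFun 2 := ⟨1, QA13, fun _ hx => (QA13_pos hx).ne'⟩

/-- `B = [□², 1/Q_B]`. -/
def B13 : RFun 2 := ⟨1, QB13, fun _ hx => (QB13_pos hx).ne'⟩

/-- `[□², 2/Q_B]`. -/
def B13two : RFun 2 := ⟨2, QB13, fun _ hx => (QB13_pos hx).ne'⟩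

/-- lower half-piece. -/
def L13 : RFun 2 := ⟨1, QL13, fun _ hx => (QL13_pos hx).ne'⟩

/-- upper half-piece. -/
def U13 : RFun 2 := ⟨1, QU13, fun _ hx => (QU13_pos hx).ne'⟩

/-- Helper (theorem) `A13_subdiv` of the dark-pairs chains (census pairs #9/#11/#13/#14 decided by KZ rules 1+2; lens-6 g6). -/
theorem A13_subdiv : KZ.of A13.rep - KZ.of L13.rep - KZ.of U13.rep ∈ KZ.relations := by
  refine rel_subdiv 0 A13 L13 U13 (fun x _ => ?_) (fun x _ => ?_)
  · simp only [A13, L13, RFun.fn, QA13, QL13, map_add, map_sub, map_mul, map_pow, map_one, map_ofNat,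
      aeval_X, Function.update_self, update_zero_apply_one]
    exact one_div_eq_mul_one_div (by norm_num) (by ring)
  · simp only [A13, U13, RFun.fn, QA13, QU13, map_add, map_sub, map_mul, map_pow, map_one, map_ofNat,
      aeval_X, Function.update_self, update_zero_apply_one]
    exact one_div_eq_mul_one_div (by norm_num) (by ring)

/-- Helper (theorem) `B13_L13` of the dark-pairs chains (census pairs #9/#11/#13/#14 decided by KZ rules 1+2; lens-6 g6). -/
theorem B13_L13 : KZ.of B13.rep - KZ.of L13.rep ∈ KZ.relations := by
  refine rel_reflect 0 L13 B13 fun x _ => ?_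
  simp only [B13, L13, RFun.fn, QB13, QL13, map_add, map_sub, map_mul, map_pow, map_one, map_ofNat,
    aeval_X, Function.update_self, update_zero_apply_one]
  congr 1; ring

/-- Helper (theorem) `B13_U13` of the dark-pairs chains (census pairs #9/#11/#13/#14 decided by KZ rules 1+2; lens-6 g6). -/
theorem B13_U13 : KZ.of B13.rep - KZ.of U13.rep ∈ KZ.relations := by
  refine rel_reflect 1 U13 B13 fun x _ => ?_
  simp only [B13, U13, RFun.fn, QB13, QU13, map_add, map_sub, map_mul, map_pow, map_one, map_ofNat,
    aeval_X, Function.update_self, update_one_apply_zero]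
  congr 1; ring

/-- **Census pair #13 decided**:
`[□², 1/(1−x+2y+2x²−2xy−y²)] − 2·[□², 1/(2−x+2y+x²+2xy−2y²)] ∈ KZ.relations`. -/
theorem pair13 : KZ.of A13.rep - 2 • KZ.of B13.rep ∈ KZ.relations :=
  rel_fold A13 B13 L13 U13 A13_subdiv B13_L13 B13_U13

/-- Helper (theorem) `pair13_equivalent` of the dark-pairs chains (census pairs #9/#11/#13/#14 decided by KZ rules 1+2; lens-6 g6). -/
theorem pair13_equivalent : KZ.Equivalent A13.rep B13two.rep := by
  have h2 := rel_double B13 B13two fun x _ => by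
    simp only [B13, B13two, RFun.fn, map_one, map_ofNat]; ring
  have : KZ.of A13.rep - KZ.of B13two.rep =
      (KZ.of A13.rep - 2 • KZ.of B13.rep) - (KZ.of B13two.rep - 2 • KZ.of B13.rep) := by abel
  show KZ.of A13.rep - KZ.of B13two.rep ∈ KZ.relations
  rw [this]
  exact KZ.relations.sub_mem pair13 h2

/-- Helper (theorem) `pair13_value` of the dark-pairs chains (census pairs #9/#11/#13/#14 decided by KZ rules 1+2; lens-6 g6). -/
theorem pair13_value : A13.rep.value = B13two.rep.value :=
  KZ.Equivalent.value_eq_holds pair13_equivalent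

end Summit.KontsevichZagierPeriods.RootDecompQuadraticDescent.DarkPairs
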